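import Summits.SmoothPoincare4.SmoothPoincare4.Theorems.SymplecticOrigamiFoldedSphereFoldExistenceFoldPullback
import Mathlib.Analysis.Calculus.LocalExtr.Basic
import Mathlib.Analysis.Convex.PathConnected

/-!
# Fold maps along a chart sphere, I: signed fold charts and the kernel line

Route `SmoothPoincare4/SymplecticOrigami`, support item `FoldedSphereFoldExistence`
(stmt-SmoothPoincare4-14076), which is closed modulo the named fact
`Literature.Topology.FourManifolds.eliashberg_foldMap_homotopySphere_four` (a fold map
`f : M → ℝ⁴` along a chart 3-sphere `Σ = e(S³)` on every smooth homotopy 4-sphere). This file and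
its sequel (`…ImmersionR5.lean`) prove Gromov's remark *Partial Differential Relations* (1986),
§2.1.3 (C″), p. 58 — "if `f : V → ℝⁿ` folds along a normally oriented hypersurface `V'` then
`f ⊕ f₀ : V → ℝⁿ⁺¹` is an immersion for a suitable function `f₀` supported near `V'`" — for the
fold maps of the named fact: **a fold map along a chart sphere lifts to an immersion
`M → ℝ⁴ × ℝ`**. Consequence recorded in the sequel: the fact implies that every smooth homotopy
4-sphere immerses in `ℝ⁵`, i.e. (Hirsch; the normal line bundle of a simply connected
hypersurface is trivial) is stably parallelisable — Kervaire–Milnor's Theorem 3.1 in dimension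
4, an open leaf of the tree (`h31` in `Literature/Barriers/SmoothPoincare4/StableInvariantsBlindFrontier`).

Here (chart level, no partition of unity yet):

* `mfderiv_chart_eq_smul_single_of_foldChart` — at a fold point the kernel of `df` is the line
  `dφ⁻¹(ℝ e₀)` of the fold chart `φ`;
* `hasDerivAt_comp_chartLine` — derivative of `g ∘ γ` at `0` for the chart line
  `γ(t) = φ⁻¹(φ x + t e₀)` is `dg(v)`, `dφ v = e₀`;
* `exists_signedFoldChart` — every fold chart can be shrunk to an open set `U` on which
  `ε φ₀ > 0` implies "outside the ball `e(B̄⁴)`" and `ε φ₀ < 0` implies "inside `e(B⁴)`", for a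
  sign `ε = ±1` (the two half-charts are connected and avoid `Σ`, which separates the open sets
  `e(B⁴)` and `M ∖ e(B̄⁴)`);
* `sign_consistency_of_signedFoldCharts` — for two signed fold charts at a fold point `x`, the
  function `ε' φ'₀` increases along the `ε`-oriented kernel line of `φ`: `0 < ε ε' (dφ' v)₀`.
-/

noncomputable section

-- the prescribed namespace `Summit.<P>.<Sub>.…` duplicates `SmoothPoincare4` (P = Sub)
set_option linter.dupNamespace false

open scoped Manifold ContDiff Topology
open Set Function Metric

namespace Summit.SmoothPoincare4.SmoothPoincare4.Theorems.FoldedSphereFoldExistence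

variable {M : Type*} [TopologicalSpace M] [ChartedSpace (EuclideanSpace ℝ (Fin 4)) M]
  [IsManifold (𝓡 4) ∞ M]

/-! ### The kernel line of a fold map in a fold chart -/

/-- **The kernel of `df` at a fold point is the chart line `ℝ · dφ⁻¹ e₀`.** In a fold chart
(`ψ ∘ f = F ∘ φ`, `F(u) = u + (u₀² - u₀) e₀`) at a point with `(φ x)₀ = 0`, if `df_x w = 0` then
`dφ_x w` is a multiple of `e₀`. [folklore] -/
theorem mfderiv_chart_eq_smul_single_of_foldChart {f : M → (EuclideanSpace ℝ (Fin 4))}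
    {φ : OpenPartialHomeomorph M (EuclideanSpace ℝ (Fin 4))} {ψ : OpenPartialHomeomorph (EuclideanSpace ℝ (Fin 4)) (EuclideanSpace ℝ (Fin 4))}
    (hφ : φ ∈ IsManifold.maximalAtlas (𝓡 4) ∞ M)
    (hψ : ψ ∈ IsManifold.maximalAtlas (𝓡 4) ∞ (EuclideanSpace ℝ (Fin 4)))
    (hsrc : φ.source ⊆ f ⁻¹' ψ.source)
    (hnf : ∀ x ∈ φ.source, ψ (f x) = φ x + ((φ x 0) ^ 2 - φ x 0) •
      EuclideanSpace.single (0 : Fin 4) (1 : ℝ))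
    {x : M} (hx : x ∈ φ.source) (hx0 : φ x 0 = 0) {w : TangentSpace (𝓡 4) x}
    (hw : mfderiv (𝓡 4) (𝓡 4) f x w = 0) :
    ∃ a : ℝ, mfderiv (𝓡 4) (𝓡 4) φ x w = a • EuclideanSpace.single (0 : Fin 4) (1 : ℝ) := by
  set u : (EuclideanSpace ℝ (Fin 4)) := mfderiv (𝓡 4) (𝓡 4) φ x w with hu
  have hinjψ := (det_fderiv_symm_ne_zero_of_mem_maximalAtlas hψ (hsrc hx)).2
  have h1 := mfderiv_foldMap_apply hφ hψ hsrc hnf hx w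
  rw [hw, foldModelDeriv_apply, hx0] at h1
  -- `D(ψ⁻¹)` is injective, so the fold-model derivative kills `u`
  have h2 : u + ((2 * 0 - 1) * u 0) • EuclideanSpace.single (0 : Fin 4) (1 : ℝ) = 0 := by
    apply hinjψ
    rw [map_zero]
    exact h1.symm
  refine ⟨u 0, ?_⟩
  have h4 : u + (-(u 0)) • EuclideanSpace.single (0 : Fin 4) (1 : ℝ) = 0 := by
    simpa using h2
  rw [neg_smul, ← sub_eq_add_neg, sub_eq_zero] at h4
  exact h4

/-- **Kernel vectors are multiples of the chart kernel vector.** With `v` the chart kernel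
vector (`dφ_x v = e₀`), every `w` with `df_x w = 0` is a multiple of `v`. [folklore] -/
theorem eq_smul_kernel_of_foldChart {f : M → (EuclideanSpace ℝ (Fin 4))}
    {φ : OpenPartialHomeomorph M (EuclideanSpace ℝ (Fin 4))} {ψ : OpenPartialHomeomorph (EuclideanSpace ℝ (Fin 4)) (EuclideanSpace ℝ (Fin 4))}
    (hφ : φ ∈ IsManifold.maximalAtlas (𝓡 4) ∞ M)
    (hψ : ψ ∈ IsManifold.maximalAtlas (𝓡 4) ∞ (EuclideanSpace ℝ (Fin 4)))
    (hsrc : φ.source ⊆ f ⁻¹' ψ.source)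
    (hnf : ∀ x ∈ φ.source, ψ (f x) = φ x + ((φ x 0) ^ 2 - φ x 0) •
      EuclideanSpace.single (0 : Fin 4) (1 : ℝ))
    {x : M} (hx : x ∈ φ.source) (hx0 : φ x 0 = 0) {v : TangentSpace (𝓡 4) x}
    (hφv : mfderiv (𝓡 4) (𝓡 4) φ x v = EuclideanSpace.single (0 : Fin 4) (1 : ℝ))
    {w : TangentSpace (𝓡 4) x} (hw : mfderiv (𝓡 4) (𝓡 4) f x w = 0) :
    ∃ a : ℝ, w = a • v := by
  have hmd := mdifferentiable_of_mem_maximalAtlas' hφ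
  set L := hmd.mfderiv hx with hL_def
  have hL : ∀ z, L z = mfderiv (𝓡 4) (𝓡 4) φ x z := fun z => rfl
  obtain ⟨a, h1⟩ := mfderiv_chart_eq_smul_single_of_foldChart hφ hψ hsrc hnf hx hx0 hw
  refine ⟨a, L.injective ?_⟩
  rw [hL, hL, ContinuousLinearMap.map_smul, hφv]
  exact h1

/-! ### Derivatives along the chart line `t ↦ φ⁻¹(φ x + t e₀)` -/

/-- **Derivative along the chart line.** For a chart `φ` of the maximal atlas, `x ∈ φ.source`,
a vector `v` with `dφ_x v = e₀` and a real function `g` with `HasMFDerivAt g x g'`, the function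
`t ↦ g (φ⁻¹ (φ x + t e₀))` has derivative `g' v` at `t = 0`. [folklore] -/
theorem hasDerivAt_comp_chartLine {φ : OpenPartialHomeomorph M (EuclideanSpace ℝ (Fin 4))}
    (hφ : φ ∈ IsManifold.maximalAtlas (𝓡 4) ∞ M) {x : M} (hx : x ∈ φ.source)
    {v : TangentSpace (𝓡 4) x}
    (hφv : mfderiv (𝓡 4) (𝓡 4) φ x v = EuclideanSpace.single (0 : Fin 4) (1 : ℝ))
    {g : M → ℝ} {g' : TangentSpace (𝓡 4) x →L[ℝ] TangentSpace 𝓘(ℝ, ℝ) (g x)}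
    (hg : HasMFDerivAt (𝓡 4) 𝓘(ℝ, ℝ) g x g') :
    HasDerivAt (fun t : ℝ => g (φ.symm (φ x + t • EuclideanSpace.single (0 : Fin 4) (1 : ℝ))))
      (g' v) 0 := by
  have hmd := mdifferentiable_of_mem_maximalAtlas' hφ
  set L := hmd.mfderiv hx with hL_def
  have hL : ∀ z, L z = mfderiv (𝓡 4) (𝓡 4) φ x z := fun z => rfl
  have hLs : ∀ u, L.symm u = mfderiv (𝓡 4) (𝓡 4) φ.symm (φ x) u := fun u => rfl
  have hv : v = L.symm (EuclideanSpace.single (0 : Fin 4) (1 : ℝ)) := by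
    rw [← hφv, ← hL, L.symm_apply_apply]
  -- the affine line in the chart
  set ℓ : ℝ → (EuclideanSpace ℝ (Fin 4)) := fun t => φ x + t • EuclideanSpace.single (0 : Fin 4) (1 : ℝ) with hℓ
  set A : ℝ →L[ℝ] (EuclideanSpace ℝ (Fin 4)) :=
    (ContinuousLinearMap.id ℝ ℝ).smulRight (EuclideanSpace.single (0 : Fin 4) (1 : ℝ)) with hA
  have hℓ0 : ℓ 0 = φ x := by simp [hℓ]
  have hℓA : ℓ = fun t => φ x + A t := by
    funext t
    simp [hℓ, hA]
  have hℓd' : HasFDerivAt ℓ A 0 := by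
    rw [hℓA]
    exact A.hasFDerivAt.const_add (φ x)
  have hℓd : HasMFDerivAt 𝓘(ℝ, ℝ) (𝓡 4) ℓ 0 A := hasMFDerivAt_iff_hasFDerivAt.2 hℓd'
  -- the inverse chart at `φ x`
  have hsymm : HasMFDerivAt (𝓡 4) (𝓡 4) φ.symm (ℓ 0)
      (mfderiv (𝓡 4) (𝓡 4) φ.symm (φ x)) := by
    rw [hℓ0]
    exact (hmd.mdifferentiableAt_symm (φ.map_source hx)).hasMFDerivAt
  have hγ : HasMFDerivAt 𝓘(ℝ, ℝ) (𝓡 4) (φ.symm ∘ ℓ) 0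
      ((mfderiv (𝓡 4) (𝓡 4) φ.symm (φ x)).comp A) :=
    hsymm.comp 0 hℓd
  have hγ0 : (φ.symm ∘ ℓ) 0 = x := by
    simp only [Function.comp_apply, hℓ0]
    exact φ.left_inv hx
  have hg' : HasMFDerivAt (𝓡 4) 𝓘(ℝ, ℝ) g ((φ.symm ∘ ℓ) 0) g' := by rw [hγ0]; exact hg
  have hcomp := hg'.comp 0 hγ
  rw [hasMFDerivAt_iff_hasFDerivAt] at hcomp
  -- read the composite differential as a plain linear map `ℝ →L[ℝ] ℝ`
  set B : ℝ →L[ℝ] ℝ := g'.comp ((mfderiv (𝓡 4) (𝓡 4) φ.symm (φ x)).comp A) with hB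
  have hcomp' : HasFDerivAt
      (fun t : ℝ => g (φ.symm (φ x + t • EuclideanSpace.single (0 : Fin 4) (1 : ℝ)))) B 0 :=
    hcomp
  have hder := hcomp'.hasDerivAt
  have hval : B (1 : ℝ) = g' v := by
    have h1 : A (1 : ℝ) = EuclideanSpace.single (0 : Fin 4) (1 : ℝ) := by
      simp [hA]
    show g' (mfderiv (𝓡 4) (𝓡 4) φ.symm (φ x) (A 1)) = g' v
    rw [h1, ← hLs, ← hv]
  exact hder.congr_deriv hval

omit [ChartedSpace (EuclideanSpace ℝ (Fin 4)) M] [IsManifold (𝓡 4) ∞ M] in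
/-- The chart line stays in the chart: for small `t`, `φ x + t e₀ ∈ φ.target`, hence
`φ (φ⁻¹ (φ x + t e₀)) = φ x + t e₀` and the point lies in any open `U ∋ x`. [folklore] -/
theorem eventually_chartLine_mem {φ : OpenPartialHomeomorph M (EuclideanSpace ℝ (Fin 4))} {x : M} (hx : x ∈ φ.source)
    {U : Set M} (hU : IsOpen U) (hxU : x ∈ U) :
    ∀ᶠ t : ℝ in 𝓝 0, φ x + t • EuclideanSpace.single (0 : Fin 4) (1 : ℝ) ∈ φ.target ∧
      φ.symm (φ x + t • EuclideanSpace.single (0 : Fin 4) (1 : ℝ)) ∈ U := by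
  have hc : Continuous fun t : ℝ => φ x + t • EuclideanSpace.single (0 : Fin 4) (1 : ℝ) :=
    continuous_const.add (continuous_id.smul continuous_const)
  have h0 : (fun t : ℝ => φ x + t • EuclideanSpace.single (0 : Fin 4) (1 : ℝ)) 0 = φ x := by simp
  have ht : Filter.Tendsto (fun t : ℝ => φ x + t • EuclideanSpace.single (0 : Fin 4) (1 : ℝ))
      (𝓝 0) (𝓝 (φ x)) := by
    simpa [h0] using hc.tendsto 0
  have h1 : ∀ᶠ t : ℝ in 𝓝 0, φ x + t • EuclideanSpace.single (0 : Fin 4) (1 : ℝ) ∈ φ.target :=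
    ht (φ.open_target.mem_nhds (φ.map_source hx))
  have h2 : ∀ᶠ t : ℝ in 𝓝 0,
      φ x + t • EuclideanSpace.single (0 : Fin 4) (1 : ℝ) ∈ φ.target ∩ φ.symm ⁻¹' U := by
    refine ht ((φ.continuousOn_symm.isOpen_inter_preimage φ.open_target hU).mem_nhds ?_)
    refine ⟨φ.map_source hx, ?_⟩
    rw [mem_preimage, φ.left_inv hx]
    exact hxU
  filter_upwards [h1, h2] with t ht1 ht2
  exact ⟨ht1, ht2.2⟩

/-! ### Inside and outside of the chart ball -/

omit [TopologicalSpace M] [ChartedSpace (EuclideanSpace ℝ (Fin 4)) M] [IsManifold (𝓡 4) ∞ M] in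
/-- Off the chart sphere `Σ = e(S³)` every point is inside `e(B⁴)` or outside `e(B̄⁴)`.
[folklore] -/
theorem mem_inside_or_outside_of_not_mem_range {e : (EuclideanSpace ℝ (Fin 4)) → M} {x : M}
    (hx : x ∉ range (fun n : (Metric.sphere (0 : (EuclideanSpace ℝ (Fin 4))) 1) => e n)) :
    x ∈ e '' ball (0 : (EuclideanSpace ℝ (Fin 4))) 1 ∨ x ∈ (e '' closedBall (0 : (EuclideanSpace ℝ (Fin 4))) 1)ᶜ := by
  by_cases h : x ∈ e '' closedBall (0 : (EuclideanSpace ℝ (Fin 4))) 1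
  · obtain ⟨y, hy, rfl⟩ := h
    rcases (mem_closedBall_zero_iff.1 hy).lt_or_eq with hlt | heq
    · exact Or.inl ⟨y, mem_ball_zero_iff.2 hlt, rfl⟩
    · exact absurd ⟨⟨y, mem_sphere_zero_iff_norm.2 heq⟩, rfl⟩ hx
  · exact Or.inr h

omit [TopologicalSpace M] [ChartedSpace (EuclideanSpace ℝ (Fin 4)) M] [IsManifold (𝓡 4) ∞ M] in
/-- The chart sphere lies in the closed chart ball. [folklore] -/
theorem range_subset_image_closedBall {e : (EuclideanSpace ℝ (Fin 4)) → M} :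
    range (fun n : (Metric.sphere (0 : (EuclideanSpace ℝ (Fin 4))) 1) => e n) ⊆ e '' closedBall (0 : (EuclideanSpace ℝ (Fin 4))) 1 := by
  rintro _ ⟨n, rfl⟩
  exact ⟨n, mem_closedBall_zero_iff.2 (mem_sphere_zero_iff_norm.1 n.2).le, rfl⟩

omit [TopologicalSpace M] [ChartedSpace (EuclideanSpace ℝ (Fin 4)) M] [IsManifold (𝓡 4) ∞ M] in
/-- For an injective `e`, the open chart ball misses the chart sphere. [folklore] -/
theorem not_mem_range_of_mem_image_ball {e : (EuclideanSpace ℝ (Fin 4)) → M} (heinj : Injective e) {x : M}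
    (hx : x ∈ e '' ball (0 : (EuclideanSpace ℝ (Fin 4))) 1) : x ∉ range (fun n : (Metric.sphere (0 : (EuclideanSpace ℝ (Fin 4))) 1) => e n) := by
  rintro ⟨n, rfl⟩
  obtain ⟨y, hy, hye⟩ := hx
  have h1 : y = (n : (EuclideanSpace ℝ (Fin 4))) := heinj hye
  have h2 : ‖y‖ = 1 := by rw [h1]; exact mem_sphere_zero_iff_norm.1 n.2
  exact (mem_ball_zero_iff.1 hy).ne h2

omit [TopologicalSpace M] [ChartedSpace (EuclideanSpace ℝ (Fin 4)) M] [IsManifold (𝓡 4) ∞ M] in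
/-- For an injective `e`, the radial point `e (t n)`, `t > 1`, lies outside `e(B̄⁴)`.
[folklore] -/
theorem radial_not_mem_image_closedBall {e : (EuclideanSpace ℝ (Fin 4)) → M} (heinj : Injective e) (n : (Metric.sphere (0 : (EuclideanSpace ℝ (Fin 4))) 1)) {t : ℝ}
    (ht : 1 < t) : e (t • (n : (EuclideanSpace ℝ (Fin 4)))) ∉ e '' closedBall (0 : (EuclideanSpace ℝ (Fin 4))) 1 := by
  rintro ⟨y, hy, hye⟩
  have h1 : y = t • (n : (EuclideanSpace ℝ (Fin 4))) := heinj hye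
  have h2 : ‖y‖ = t := by
    rw [h1, norm_smul, mem_sphere_zero_iff_norm.1 n.2, mul_one, Real.norm_eq_abs,
      abs_of_pos (one_pos.trans ht)]
  exact (mem_closedBall_zero_iff.1 hy).not_gt (h2 ▸ ht)

omit [TopologicalSpace M] [ChartedSpace (EuclideanSpace ℝ (Fin 4)) M] [IsManifold (𝓡 4) ∞ M] in
/-- The radial point `e (t n)`, `0 < t < 1`, lies inside `e(B⁴)`. [folklore] -/
theorem radial_mem_image_ball {e : (EuclideanSpace ℝ (Fin 4)) → M} (n : (Metric.sphere (0 : (EuclideanSpace ℝ (Fin 4))) 1)) {t : ℝ} (ht0 : 0 < t) (ht1 : t < 1) :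
    e (t • (n : (EuclideanSpace ℝ (Fin 4)))) ∈ e '' ball (0 : (EuclideanSpace ℝ (Fin 4))) 1 := by
  refine ⟨t • (n : (EuclideanSpace ℝ (Fin 4))), mem_ball_zero_iff.2 ?_, rfl⟩
  rw [norm_smul, mem_sphere_zero_iff_norm.1 n.2, mul_one, Real.norm_eq_abs, abs_of_pos ht0]
  exact ht1

/-! ### Signed fold charts -/

omit [IsManifold (𝓡 4) ∞ M] in
/-- **Signed fold charts.** A fold chart `φ` at `e n` (Gromov's normal form
`ψ ∘ f ∘ φ⁻¹ = (u₀², u₁, u₂, u₃)`, `Σ ∩ φ.source = {u₀ = 0}`) restricts to an open `U ∋ e n`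
carrying a sign `ε = ±1` such that on `U`, `ε φ₀ > 0` only outside the closed chart ball
`e(B̄⁴)` and `ε φ₀ < 0` only inside the open chart ball `e(B⁴)`. Proof: take `U` the preimage
of a small chart ball; its two halves `{±φ₀ > 0}` are connected (images of convex sets), miss
`Σ`, hence each lies inside or outside (these are disjoint open sets covering `M ∖ Σ`), and not
both on the same side since `e n` is approached by the inside points `e(t n)`, `t < 1`, and the
outside points `e(t n)`, `t > 1`. [folklore] -/
theorem exists_signedFoldChart [T2Space M] {e : (EuclideanSpace ℝ (Fin 4)) → M} (hec : Continuous e)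
    (heinj : Injective e) (heo : IsOpenMap e) {f : M → (EuclideanSpace ℝ (Fin 4))} (n : (Metric.sphere (0 : (EuclideanSpace ℝ (Fin 4))) 1))
    (hfold : ∃ (φ : OpenPartialHomeomorph M (EuclideanSpace ℝ (Fin 4))) (ψ : OpenPartialHomeomorph (EuclideanSpace ℝ (Fin 4)) (EuclideanSpace ℝ (Fin 4))),
      e n ∈ φ.source ∧ φ ∈ IsManifold.maximalAtlas (𝓡 4) ∞ M ∧
      ψ ∈ IsManifold.maximalAtlas (𝓡 4) ∞ (EuclideanSpace ℝ (Fin 4)) ∧ φ.source ⊆ f ⁻¹' ψ.source ∧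
      (∀ x ∈ φ.source, ψ (f x) = φ x + ((φ x 0) ^ 2 - φ x 0) •
        EuclideanSpace.single (0 : Fin 4) (1 : ℝ)) ∧
      (∀ x ∈ φ.source, x ∈ range (fun n : (Metric.sphere (0 : (EuclideanSpace ℝ (Fin 4))) 1) => e n) ↔ φ x 0 = 0)) :
    ∃ (φ : OpenPartialHomeomorph M (EuclideanSpace ℝ (Fin 4))) (ψ : OpenPartialHomeomorph (EuclideanSpace ℝ (Fin 4)) (EuclideanSpace ℝ (Fin 4))) (U : Set M) (ε : ℝ),
      φ ∈ IsManifold.maximalAtlas (𝓡 4) ∞ M ∧ ψ ∈ IsManifold.maximalAtlas (𝓡 4) ∞ (EuclideanSpace ℝ (Fin 4)) ∧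
      φ.source ⊆ f ⁻¹' ψ.source ∧
      (∀ x ∈ φ.source, ψ (f x) = φ x + ((φ x 0) ^ 2 - φ x 0) •
        EuclideanSpace.single (0 : Fin 4) (1 : ℝ)) ∧
      (∀ x ∈ φ.source, x ∈ range (fun n : (Metric.sphere (0 : (EuclideanSpace ℝ (Fin 4))) 1) => e n) ↔ φ x 0 = 0) ∧
      IsOpen U ∧ e n ∈ U ∧ U ⊆ φ.source ∧ (ε = 1 ∨ ε = -1) ∧
      ∀ y ∈ U, (0 < ε * φ y 0 → y ∉ e '' closedBall (0 : (EuclideanSpace ℝ (Fin 4))) 1) ∧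
        (ε * φ y 0 < 0 → y ∈ e '' ball (0 : (EuclideanSpace ℝ (Fin 4))) 1) := by
  obtain ⟨φ, ψ, hmem, hφ, hψ, hsrc, hnf, hZ⟩ := hfold
  -- a chart ball around `c = φ (e n)` inside the target
  set c : (EuclideanSpace ℝ (Fin 4)) := φ (e n) with hc
  obtain ⟨r, hr, hball⟩ : ∃ r > 0, ball c r ⊆ φ.target :=
    Metric.isOpen_iff.1 φ.open_target c (φ.map_source hmem)
  set U : Set M := φ.source ∩ φ ⁻¹' ball c r with hU
  have hUo : IsOpen U := φ.isOpen_inter_preimage isOpen_ball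
  have hnU : e n ∈ U := ⟨hmem, mem_ball_self hr⟩
  have hUs : U ⊆ φ.source := inter_subset_left
  -- the two open pieces of `M ∖ Σ`
  set ins : Set M := e '' ball (0 : (EuclideanSpace ℝ (Fin 4))) 1 with hins
  set out : Set M := (e '' closedBall (0 : (EuclideanSpace ℝ (Fin 4))) 1)ᶜ with hout
  have hinso : IsOpen ins := heo _ isOpen_ball
  have houto : IsOpen out := ((isCompact_closedBall (0 : (EuclideanSpace ℝ (Fin 4))) 1).image hec).isClosed.isOpen_compl
  have hdisj : Disjoint ins out :=
    disjoint_compl_right.mono_left (image_mono ball_subset_closedBall)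
  have hins_out : ∀ y, y ∈ ins → y ∉ out := fun y hy hy' => hy' (image_mono ball_subset_closedBall hy)
  -- the half charts
  set Up : Set M := {y | y ∈ U ∧ 0 < φ y 0} with hUp
  set Um : Set M := {y | y ∈ U ∧ φ y 0 < 0} with hUm
  have hhalf : ∀ (S : Set (EuclideanSpace ℝ (Fin 4))), Convex ℝ S →
      IsPreconnected (φ.symm '' (ball c r ∩ S)) := fun S hS =>
    ((convex_ball c r).inter hS).isPreconnected.image _
      (φ.continuousOn_symm.mono (inter_subset_left.trans hball))
  have himage : ∀ (S : Set (EuclideanSpace ℝ (Fin 4))), {y | y ∈ U ∧ φ y ∈ S} = φ.symm '' (ball c r ∩ S) := by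
    intro S
    ext y
    constructor
    · rintro ⟨⟨hys, hyb⟩, hyS⟩
      exact ⟨φ y, ⟨hyb, hyS⟩, φ.left_inv hys⟩
    · rintro ⟨u, ⟨hub, huS⟩, rfl⟩
      have hut : u ∈ φ.target := hball hub
      refine ⟨⟨φ.map_target hut, ?_⟩, ?_⟩
      · rw [mem_preimage, φ.right_inv hut]; exact hub
      · rw [φ.right_inv hut]; exact huS
  have hlin : IsLinearMap ℝ fun u : (EuclideanSpace ℝ (Fin 4)) => u 0 := ⟨fun u v => by simp, fun a u => by simp⟩
  have hUp_pre : IsPreconnected Up := by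
    have h := himage {u : (EuclideanSpace ℝ (Fin 4)) | 0 < u 0}
    rw [show Up = {y | y ∈ U ∧ φ y ∈ {u : (EuclideanSpace ℝ (Fin 4)) | 0 < u 0}} from rfl, h]
    exact hhalf _ (convex_halfSpace_gt hlin 0)
  have hUm_pre : IsPreconnected Um := by
    have h := himage {u : (EuclideanSpace ℝ (Fin 4)) | u 0 < 0}
    rw [show Um = {y | y ∈ U ∧ φ y ∈ {u : (EuclideanSpace ℝ (Fin 4)) | u 0 < 0}} from rfl, h]
    exact hhalf _ (convex_halfSpace_lt hlin 0)
  -- both halves miss `Σ`, hence lie inside or outside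
  have hside : ∀ S : Set M, IsPreconnected S → (∀ y ∈ S, y ∈ U ∧ φ y 0 ≠ 0) →
      S ⊆ ins ∨ S ⊆ out := by
    intro S hS hSU
    have hsub : S ⊆ ins ∪ out := by
      intro y hy
      have hyS : y ∉ range (fun n : (Metric.sphere (0 : (EuclideanSpace ℝ (Fin 4))) 1) => e n) := fun h =>
        (hSU y hy).2 ((hZ y (hUs (hSU y hy).1)).1 h)
      exact mem_inside_or_outside_of_not_mem_range hyS
    exact hS.subset_or_subset hinso houto hdisj hsub
  have hUp_side : Up ⊆ ins ∨ Up ⊆ out := hside Up hUp_pre fun y hy => ⟨hy.1, hy.2.ne'⟩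
  have hUm_side : Um ⊆ ins ∨ Um ⊆ out := hside Um hUm_pre fun y hy => ⟨hy.1, hy.2.ne⟩
  -- points of `U` off `Σ` lie in one of the halves
  have hmem_half : ∀ y ∈ U, y ∉ range (fun n : (Metric.sphere (0 : (EuclideanSpace ℝ (Fin 4))) 1) => e n) → y ∈ Up ∨ y ∈ Um := by
    intro y hyU hyS
    have h0 : φ y 0 ≠ 0 := fun h => hyS ((hZ y (hUs hyU)).2 h)
    rcases lt_or_gt_of_ne h0 with h | h
    · exact Or.inr ⟨hyU, h⟩
    · exact Or.inl ⟨hyU, h⟩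
  -- an inside point and an outside point of `U`, on the ray through `n`
  have hg : Continuous fun t : ℝ => e (t • (n : (EuclideanSpace ℝ (Fin 4)))) := hec.comp (continuous_id.smul continuous_const)
  have hev : ∀ᶠ t : ℝ in 𝓝 1, e (t • (n : (EuclideanSpace ℝ (Fin 4)))) ∈ U := by
    have h := hg.tendsto 1
    rw [one_smul] at h
    exact h (hUo.mem_nhds hnU)
  obtain ⟨t₁, ht₁U, ht₁⟩ : ∃ t, e (t • (n : (EuclideanSpace ℝ (Fin 4)))) ∈ U ∧ t ∈ Ioo (0 : ℝ) 1 :=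
    ((hev.filter_mono nhdsWithin_le_nhds).and (Ioo_mem_nhdsLT one_pos)).exists
  obtain ⟨t₂, ht₂U, ht₂⟩ : ∃ t, e (t • (n : (EuclideanSpace ℝ (Fin 4)))) ∈ U ∧ t ∈ Ioo (1 : ℝ) 2 :=
    ((hev.filter_mono nhdsWithin_le_nhds).and (Ioo_mem_nhdsGT one_lt_two)).exists
  have hp₁ins : e (t₁ • (n : (EuclideanSpace ℝ (Fin 4)))) ∈ ins := radial_mem_image_ball n ht₁.1 ht₁.2
  have hp₂out : e (t₂ • (n : (EuclideanSpace ℝ (Fin 4)))) ∈ out := radial_not_mem_image_closedBall heinj n ht₂.1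
  have hp₁half := hmem_half _ ht₁U (not_mem_range_of_mem_image_ball heinj hp₁ins)
  have hp₂half := hmem_half _ ht₂U fun h => hp₂out (range_subset_image_closedBall h)
  -- choose the sign
  by_cases hcase : Up ⊆ out
  · -- `ε = 1`: then `Um ⊆ ins`
    have hUm_ins : Um ⊆ ins := by
      rcases hUm_side with h | h
      · exact h
      · exfalso
        rcases hp₁half with h1 | h1
        · exact hins_out _ hp₁ins (hcase h1)
        · exact hins_out _ hp₁ins (h h1)
    refine ⟨φ, ψ, U, 1, hφ, hψ, hsrc, hnf, hZ, hUo, hnU, hUs, Or.inl rfl, fun y hyU => ⟨?_, ?_⟩⟩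
    · intro h
      rw [one_mul] at h
      exact hcase ⟨hyU, h⟩
    · intro h
      rw [one_mul] at h
      exact hUm_ins ⟨hyU, h⟩
  · -- `ε = -1`: then `Up ⊆ ins` and `Um ⊆ out`
    have hUp_ins : Up ⊆ ins := hUp_side.resolve_right hcase
    have hUm_out : Um ⊆ out := by
      rcases hUm_side with h | h
      · exfalso
        rcases hp₂half with h2 | h2
        · exact hins_out _ (hUp_ins h2) hp₂out
        · exact hins_out _ (h h2) hp₂out
      · exact h
    refine ⟨φ, ψ, U, -1, hφ, hψ, hsrc, hnf, hZ, hUo, hnU, hUs, Or.inr rfl, fun y hyU => ⟨?_, ?_⟩⟩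
    · intro h
      have h' : φ y 0 < 0 := by linarith
      exact hUm_out ⟨hyU, h'⟩
    · intro h
      have h' : 0 < φ y 0 := by linarith
      exact hUp_ins ⟨hyU, h'⟩

end Summit.SmoothPoincare4.SmoothPoincare4.Theorems.FoldedSphereFoldExistence

end
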